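import Literature.Probability.Distributions.ComplexGaussianVectors
import Literature.Probability.RandomMatrix.ComplexGaussianVector
import Literature.Analysis.InnerProduct.GramSchmidt
import Literature.MathematicalPhysics.QuantumFieldTheory.StrongCouplingActivities
import HarnessLib

/-!
# The first columns of a Haar unitary are the Gram–Schmidt orthonormalisation of Gaussian vectors

`Literature/Probability/RandomMatrix/`. For `q ≤ m`, the `q` first columns of a Haar-random
`U ∈ U(m)` — a random orthonormal `q`-frame of `ℂ^m` — have the law of the Gram–Schmidt
orthonormalisation `GSN(g₁, …, g_q)` of `q` independent standard complex Gaussian vectors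
(`map_firstCols_haar_eq_map_gramSchmidtNormed`). This is the "QR / Gram–Schmidt algorithm" for
sampling the Haar measure (Mezzadri, *How to generate random matrices from the classical compact
groups*, Notices AMS 54 (2007) 592–604, §4–§5; the Ginibre ensemble is bi-unitarily invariant
and Gram–Schmidt is equivariant) and the starting point of the computation of the law of
truncations of Haar unitaries (`HaarCornerDensity.lean`, Collins 2005 Thm. 5.1, towards
`Literature.Computability.QuantumComplexity.truncatedHaarDensity`).

## Proof

Let `γ = γ_m^{⊗q}` be the law of the Gaussian tuple, `H` the Haar probability measure of `U(m)`,
`Ψ = GSN`, `C(U)` the first `q` columns of `U`, and let `U ∈ U(m)` act on tuples diagonally.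
For measurable `B`,
`γ(Ψ⁻¹B) = ∫_U γ((U·)⁻¹Ψ⁻¹B) dH = ∫_U ∫_f 𝟙_B(Ψ(U·f)) dγ dH = ∫_f ∫_U 𝟙_B(U·Ψ f) dH dγ`
(invariance of `γ` under each `U`, `stdGaussian_map_complexLinearIsometryEquiv`; equivariance
`Ψ(U·f) = U·Ψ(f)`, `gramSchmidtNormed_map_linearIsometry`; Tonelli). For `γ`-a.e. `f` the family
is linearly independent (`ae_linearIndependent_gaussianCols`: a Gaussian vector avoids the span
of the previous ones, a proper subspace), so `w = Ψ f` is orthonormal and is the frame of first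
columns of some `W ∈ U(m)` (`exists_unitary_firstCols_eq`); then `U·w = C(UW)` and by right
invariance of `H` the inner integral is `∫ 𝟙_B(C(U)) dH = (C_* H)(B)`, independently of `f`.

All [folklore] except the named result, [cite: Mezzadri2007, §5].
-/

noncomputable section

open MeasureTheory ProbabilityTheory Set Module Matrix InnerProductSpace
open Literature.Probability.Distributions Literature.Analysis.InnerProduct
open Literature.MathematicalPhysics.QuantumFieldTheory (haarProbability)
open scoped ENNReal InnerProductSpace

namespace Literature.Probability.RandomMatrix

variable {m : ℕ}

/-! ### Unitary matrices acting on tuples of vectors of `ℂ^m`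

A unitary matrix acts on `ℂ^m = EuclideanSpace ℂ (Fin m)` through the linear isometric
equivalence `unitaryEuclidean U : v ↦ U v` of `ComplexGaussianVector.lean`. -/

/-- The diagonal action of `U(m)` on `q`-tuples of vectors of `ℂ^m`. [folklore] -/
def tupleAct (q : ℕ) (U : unitaryGroup (Fin m) ℂ) (f : Fin q → EuclideanSpace ℂ (Fin m)) :
    Fin q → EuclideanSpace ℂ (Fin m) :=
  fun j => unitaryEuclidean U (f j)

/-- `tupleAct` unfolds. [folklore] -/
@[simp] theorem tupleAct_apply (q : ℕ) (U : unitaryGroup (Fin m) ℂ)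
    (f : Fin q → EuclideanSpace ℂ (Fin m)) (j : Fin q) : tupleAct q U f j = unitaryEuclidean U (f j) :=
  rfl

/-- The diagonal action is jointly continuous in `(U, f)`. [folklore] -/
theorem continuous_tupleAct (q : ℕ) :
    Continuous fun p : unitaryGroup (Fin m) ℂ × (Fin q → EuclideanSpace ℂ (Fin m)) =>
      tupleAct q p.1 p.2 := by
  refine continuous_pi fun j => ?_
  simp only [tupleAct_apply, unitaryEuclidean_apply]
  refine (PiLp.continuous_toLp 2 _).comp (continuous_pi fun i => ?_)
  simp only [mulVec, dotProduct]
  refine continuous_finsetSum _ fun k _ => Continuous.mul ?_ ?_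
  · exact (continuous_apply_apply i k).comp (continuous_subtype_val.comp continuous_fst)
  · exact (continuous_apply k).comp ((PiLp.continuous_ofLp 2 _).comp
      ((continuous_apply j).comp continuous_snd))

/-- For fixed `U` the action on tuples is measurable. [folklore] -/
theorem measurable_tupleAct (q : ℕ) (U : unitaryGroup (Fin m) ℂ) : Measurable (tupleAct q U) :=
  ((continuous_tupleAct q).comp (Continuous.prodMk_right U)).measurable

/-! ### The Gaussian tuple and its invariance -/

variable (m) in
/-- The law `γ_m^{⊗q}` of `q` independent standard complex Gaussian vectors of `ℂ^m` (real and
imaginary parts of all coordinates i.i.d. `N(0,1)`; the normalisation is immaterial for the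
Gram–Schmidt frame). [folklore] -/
def gaussianCols (q : ℕ) : Measure (Fin q → EuclideanSpace ℂ (Fin m)) :=
  Measure.pi fun _ => stdGaussian (EuclideanSpace ℂ (Fin m))

/-- The Gaussian tuple law is a probability measure. [folklore] -/
instance (q : ℕ) : IsProbabilityMeasure (gaussianCols m q) := by
  unfold gaussianCols; infer_instance

/-- **Unitary invariance of the Gaussian tuple**: `U · γ = γ` for every `U ∈ U(m)`. [folklore] -/
theorem measurePreserving_tupleAct (q : ℕ) (U : unitaryGroup (Fin m) ℂ) :
    MeasurePreserving (tupleAct q U) (gaussianCols m q) (gaussianCols m q) := by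
  unfold gaussianCols
  refine measurePreserving_pi _ _ fun _ => ⟨(unitaryEuclidean U).continuous.measurable, ?_⟩
  exact stdGaussian_map_complexLinearIsometryEquiv (unitaryEuclidean U)

/-- **Equivariance of Gram–Schmidt**: `GSN (U · f) = U · GSN f`. [folklore] -/
theorem gramSchmidtNormed_tupleAct (q : ℕ) (U : unitaryGroup (Fin m) ℂ)
    (f : Fin q → EuclideanSpace ℂ (Fin m)) :
    gramSchmidtNormed ℂ (tupleAct q U f) = tupleAct q U (gramSchmidtNormed ℂ f) := by
  funext j
  exact gramSchmidtNormed_map_linearIsometry ℂ (unitaryEuclidean U).toLinearIsometry f j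

/-! ### Gaussian vectors are almost surely linearly independent -/

/-- Appending a vector to a tuple is continuous. [folklore] -/
theorem continuous_snoc (q : ℕ) :
    Continuous fun p : EuclideanSpace ℂ (Fin m) × (Fin q → EuclideanSpace ℂ (Fin m)) =>
      (Fin.snoc p.2 p.1 : Fin (q + 1) → EuclideanSpace ℂ (Fin m)) := by
  refine continuous_pi fun i => ?_
  refine Fin.lastCases ?_ (fun j => ?_) i
  · simp only [Fin.snoc_last]; exact continuous_fst
  · simp only [Fin.snoc_castSucc]; exact (continuous_apply j).comp continuous_snd

/-- **`q ≤ m` independent Gaussian vectors of `ℂ^m` are a.s. linearly independent**: by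
induction on `q`, the last vector avoids the span of the previous ones, a proper subspace, almost
surely (`stdGaussian_apply_complexSubmodule_eq_zero` and Fubini). [folklore] -/
theorem ae_linearIndependent_gaussianCols {q : ℕ} (hq : q ≤ m) :
    ∀ᵐ f ∂(gaussianCols m q), LinearIndependent ℂ f := by
  induction q with
  | zero => exact ae_of_all _ fun f => linearIndependent_empty_type
  | succ q ih =>
    have hq' : q ≤ m := (Nat.le_succ q).trans hq
    set γ : Measure (EuclideanSpace ℂ (Fin m)) := stdGaussian (EuclideanSpace ℂ (Fin m)) with hγ
    -- split off the last vector
    have hmp : MeasurePreserving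
        (MeasurableEquiv.piFinSuccAbove (fun _ : Fin (q + 1) => EuclideanSpace ℂ (Fin m)) (Fin.last q))
        (gaussianCols m (q + 1)) (γ.prod (gaussianCols m q)) :=
      measurePreserving_piFinSuccAbove (fun _ : Fin (q + 1) => stdGaussian (EuclideanSpace ℂ (Fin m)))
        (Fin.last q)
    have hsymm : ∀ x : EuclideanSpace ℂ (Fin m) × (Fin q → EuclideanSpace ℂ (Fin m)),
        (MeasurableEquiv.piFinSuccAbove (fun _ : Fin (q + 1) => EuclideanSpace ℂ (Fin m)) (Fin.last q)).symm x =
          Fin.snoc x.2 x.1 := by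
      intro x
      rw [MeasurableEquiv.piFinSuccAbove_symm_apply, Fin.insertNthEquiv_last]
      rfl
    -- the bad set, transported to the product
    set T : Set (EuclideanSpace ℂ (Fin m) × (Fin q → EuclideanSpace ℂ (Fin m))) :=
      {p | ¬ LinearIndependent ℂ (Fin.snoc p.2 p.1 : Fin (q + 1) → EuclideanSpace ℂ (Fin m))}
      with hT
    have hopen : IsOpen {f : Fin (q + 1) → EuclideanSpace ℂ (Fin m) | LinearIndependent ℂ f} :=
      isOpen_setOf_linearIndependent
    have hTeq : T = (fun p : EuclideanSpace ℂ (Fin m) × (Fin q → EuclideanSpace ℂ (Fin m)) =>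
        (Fin.snoc p.2 p.1 : Fin (q + 1) → EuclideanSpace ℂ (Fin m))) ⁻¹'
          {f : Fin (q + 1) → EuclideanSpace ℂ (Fin m) | LinearIndependent ℂ f}ᶜ := rfl
    have hTm : MeasurableSet T := by
      rw [hTeq]
      exact hopen.measurableSet.compl.preimage (continuous_snoc q).measurable
    have hST : {f : Fin (q + 1) → EuclideanSpace ℂ (Fin m) | ¬ LinearIndependent ℂ f} =
        (MeasurableEquiv.piFinSuccAbove (fun _ : Fin (q + 1) => EuclideanSpace ℂ (Fin m)) (Fin.last q)) ⁻¹' T := by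
      ext f
      simp only [mem_setOf_eq, mem_preimage, hT]
      rw [← hsymm, MeasurableEquiv.symm_apply_apply]
    rw [ae_iff, hST, hmp.measure_preimage hTm.nullMeasurableSet]
    -- `T ⊆ T₁ ∪ T₂`
    set T₁ : Set (EuclideanSpace ℂ (Fin m) × (Fin q → EuclideanSpace ℂ (Fin m))) :=
      (univ : Set (EuclideanSpace ℂ (Fin m))) ×ˢ {g | ¬ LinearIndependent ℂ g} with hT₁
    set T₂ : Set (EuclideanSpace ℂ (Fin m) × (Fin q → EuclideanSpace ℂ (Fin m))) :=
      {p | LinearIndependent ℂ p.2 ∧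
        ¬ LinearIndependent ℂ (Fin.snoc p.2 p.1 : Fin (q + 1) → EuclideanSpace ℂ (Fin m))} with hT₂
    have hsub : T ⊆ T₁ ∪ T₂ := by
      intro p hp
      by_cases hg : LinearIndependent ℂ p.2
      · exact Or.inr ⟨hg, hp⟩
      · exact Or.inl ⟨mem_univ _, hg⟩
    refine measure_mono_null hsub (measure_union_null ?_ ?_)
    · -- `T₁` is null by the induction hypothesis
      rw [hT₁, Measure.prod_prod, ae_iff.1 (ih hq'), mul_zero]
    · -- `T₂`: for a linearly independent `g`, the section is the proper subspace `span g`
      have hT₂m : MeasurableSet T₂ :=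
        ((isOpen_setOf_linearIndependent.preimage continuous_snd).measurableSet).inter hTm
      rw [Measure.prod_apply_symm hT₂m]
      refine (lintegral_congr fun g => ?_).trans lintegral_zero
      by_cases hg : LinearIndependent ℂ g
      · have hsec : (fun x => (x, g)) ⁻¹' T₂ =
            (Submodule.span ℂ (Set.range g) : Set (EuclideanSpace ℂ (Fin m))) := by
          ext x
          simp only [hT₂, mem_preimage, mem_setOf_eq, linearIndependent_finSnoc, not_and,
            not_not]
          exact ⟨fun h => h.2 hg, fun h => ⟨hg, fun _ => h⟩⟩
        rw [hsec]
        refine stdGaussian_apply_complexSubmodule_eq_zero _ fun htop => ?_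
        have h1 : finrank ℂ (Submodule.span ℂ (Set.range g)) = q := by
          simpa using finrank_span_eq_card hg
        rw [htop, finrank_top, finrank_euclideanSpace, Fintype.card_fin] at h1
        omega
      · have hsec : (fun x => (x, g)) ⁻¹' T₂ = ∅ := by
          ext x
          simp only [hT₂, mem_preimage, mem_setOf_eq, mem_empty_iff_false, iff_false, not_and]
          exact fun h => absurd h hg
        rw [hsec, measure_empty]

/-! ### The first columns of a unitary -/

variable (m) in
/-- The first `q` columns of `U ∈ U(m)` (`q ≤ m`) as a `q`-tuple of vectors of `ℂ^m`.
[folklore] -/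
def firstCols (q : ℕ) (h : q ≤ m) (U : unitaryGroup (Fin m) ℂ) : Fin q → EuclideanSpace ℂ (Fin m) :=
  fun j => WithLp.toLp 2 fun i => (U : Matrix (Fin m) (Fin m) ℂ) i (Fin.castLE h j)

/-- Coordinates of `firstCols`. [folklore] -/
@[simp] theorem firstCols_apply (q : ℕ) (h : q ≤ m) (U : unitaryGroup (Fin m) ℂ) (j : Fin q)
    (i : Fin m) : firstCols m q h U j i = (U : Matrix (Fin m) (Fin m) ℂ) i (Fin.castLE h j) := rfl

/-- `firstCols` is continuous. [folklore] -/
theorem continuous_firstCols (q : ℕ) (h : q ≤ m) : Continuous (firstCols m q h) := by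
  refine continuous_pi fun j => (PiLp.continuous_toLp 2 _).comp (continuous_pi fun i => ?_)
  exact (continuous_apply_apply i (Fin.castLE h j)).comp continuous_subtype_val

/-- Left multiplication acts on the first columns through the diagonal action:
`C(UW) = U · C(W)`. [folklore] -/
theorem firstCols_mul (q : ℕ) (h : q ≤ m) (U W : unitaryGroup (Fin m) ℂ) :
    firstCols m q h (U * W) = tupleAct q U (firstCols m q h W) := by
  funext j
  refine PiLp.ext fun i => ?_
  change ((U : Matrix (Fin m) (Fin m) ℂ) * (W : Matrix (Fin m) (Fin m) ℂ)) i (Fin.castLE h j) =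
    ((U : Matrix (Fin m) (Fin m) ℂ) *ᵥ fun k => (W : Matrix (Fin m) (Fin m) ℂ) k (Fin.castLE h j)) i
  rw [Matrix.mul_apply]
  rfl

/-- **Every orthonormal `q`-frame is the frame of first columns of a unitary** (extend to an
orthonormal basis of `ℂ^m`; the matrix of an orthonormal basis is unitary). [folklore] -/
theorem exists_unitary_firstCols_eq {q : ℕ} (h : q ≤ m) {w : Fin q → EuclideanSpace ℂ (Fin m)}
    (hw : Orthonormal ℂ w) : ∃ W : unitaryGroup (Fin m) ℂ, firstCols m q h W = w := by
  have hli : LinearIndependent ℂ w := hw.linearIndependent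
  let K : Submodule ℂ (EuclideanSpace ℂ (Fin m)) := Submodule.span ℂ (Set.range w)
  -- an orthonormal basis of `K` made of the `w j`
  let f : Fin q → K := fun j => ⟨w j, Submodule.subset_span (Set.mem_range_self j)⟩
  have hf : Orthonormal ℂ f := by
    have hw' := hw
    rw [orthonormal_iff_ite] at hw' ⊢
    intro i j
    rw [Submodule.coe_inner]
    exact hw' i j
  have hrange : Set.range f = ((↑) : K → EuclideanSpace ℂ (Fin m)) ⁻¹' Set.range w := by
    ext x
    constructor
    · rintro ⟨j, rfl⟩; exact ⟨j, rfl⟩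
    · rintro ⟨j, hj⟩; exact ⟨j, Subtype.ext hj⟩
  let b₁ : OrthonormalBasis (Fin q) ℂ K := OrthonormalBasis.mk hf (by
    rw [hrange, Submodule.span_span_coe_preimage])
  have hb₁ : ∀ j, (b₁ j : EuclideanSpace ℂ (Fin m)) = w j := fun j => by
    simp [b₁, f]
  -- an orthonormal basis of `Kᗮ`, indexed by `Fin (m - q)`
  have hKq : finrank ℂ K = q := (finrank_span_eq_card hli).trans (Fintype.card_fin q)
  have hKo : finrank ℂ Kᗮ = m - q := by
    have := Submodule.finrank_add_finrank_orthogonal K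
    rw [hKq, finrank_euclideanSpace, Fintype.card_fin] at this
    omega
  let b₂ : OrthonormalBasis (Fin (m - q)) ℂ Kᗮ := (stdOrthonormalBasis ℂ Kᗮ).reindex (finCongr hKo)
  have hqm : q + (m - q) = m := by omega
  let ε : Fin q ⊕ Fin (m - q) ≃ Fin m := finSumFinEquiv.trans (finCongr hqm)
  let c : OrthonormalBasis (Fin m) ℂ (EuclideanSpace ℂ (Fin m)) :=
    (K.sumOrthonormalBasis b₁ b₂).reindex ε
  have hε : ∀ j : Fin q, ε.symm (Fin.castLE h j) = Sum.inl j := by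
    intro j
    rw [Equiv.symm_apply_eq]
    ext
    simp [ε, Fin.castAdd, Fin.castLE]
  have hc : ∀ j : Fin q, c (Fin.castLE h j) = w j := by
    intro j
    simp only [c, OrthonormalBasis.reindex_apply, hε, Submodule.sumOrthonormalBasis_apply_inl, hb₁]
  -- the unitary whose columns are the `c k`
  refine ⟨⟨(EuclideanSpace.basisFun (Fin m) ℂ).toBasis.toMatrix c,
    (EuclideanSpace.basisFun (Fin m) ℂ).toMatrix_orthonormalBasis_mem_unitary c⟩, ?_⟩
  funext j
  refine PiLp.ext fun i => ?_
  rw [← hc j]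
  change ((EuclideanSpace.basisFun (Fin m) ℂ).toBasis.toMatrix c) i (Fin.castLE h j) = c (Fin.castLE h j) i
  rw [Module.Basis.toMatrix_apply, OrthonormalBasis.coe_toBasis_repr_apply, EuclideanSpace.basisFun_repr]

/-! ### The theorem -/

/-- **The first `q` columns of a Haar unitary have the law of the Gram–Schmidt
orthonormalisation of `q` independent standard Gaussian vectors** (`q ≤ m`):
`C_* Haar_{U(m)} = GSN_* γ_m^{⊗q}` as measures on `q`-tuples of vectors of `ℂ^m` — the
Gram–Schmidt / QR algorithm for sampling Haar unitaries (Mezzadri 2007, §5: "apply the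
Gram–Schmidt orthonormalization to the columns of a Ginibre matrix"), by bi-unitary invariance of
the Gaussian tuple, equivariance of Gram–Schmidt, and uniqueness through right invariance of the
Haar measure (see the module docstring). [cite: Mezzadri2007, §5] -/
theorem map_firstCols_haar_eq_map_gramSchmidtNormed {q : ℕ} (h : q ≤ m) :
    (haarProbability (unitaryGroup (Fin m) ℂ)).map (firstCols m q h) =
      (gaussianCols m q).map (gramSchmidtNormed ℂ) := by
  set H : Measure (unitaryGroup (Fin m) ℂ) := haarProbability (unitaryGroup (Fin m) ℂ) with hH
  set γ : Measure (Fin q → EuclideanSpace ℂ (Fin m)) := gaussianCols m q with hγ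
  have hΨ : Measurable (gramSchmidtNormed ℂ :
      (Fin q → EuclideanSpace ℂ (Fin m)) → Fin q → EuclideanSpace ℂ (Fin m)) :=
    measurable_gramSchmidtNormed ℂ
  have hC : Measurable (firstCols m q h) := (continuous_firstCols q h).measurable
  ext B hB
  rw [Measure.map_apply hC hB, Measure.map_apply hΨ hB]
  set φ : (Fin q → EuclideanSpace ℂ (Fin m)) → ℝ≥0∞ := B.indicator 1 with hφ
  have hφm : Measurable φ := measurable_one.indicator hB
  -- the Haar side as an integral
  have hHaar : H (firstCols m q h ⁻¹' B) = ∫⁻ U, φ (firstCols m q h U) ∂H := by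
    rw [← lintegral_indicator_one (hC hB)]
    refine lintegral_congr fun U => ?_
    rw [hφ, ← Set.indicator_comp_right (firstCols m q h), Pi.one_comp]
  -- Step 1: for every `U`, `γ(Ψ⁻¹ B) = ∫ φ(U · Ψ f) dγ(f)`
  have step1 : ∀ U : unitaryGroup (Fin m) ℂ,
      γ (gramSchmidtNormed ℂ ⁻¹' B) = ∫⁻ f, φ (tupleAct q U (gramSchmidtNormed ℂ f)) ∂γ := by
    intro U
    rw [← (measurePreserving_tupleAct q U).measure_preimage (hΨ hB).nullMeasurableSet,
      ← lintegral_indicator_one ((measurable_tupleAct q U) (hΨ hB))]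
    refine lintegral_congr fun f => ?_
    rw [hφ, ← gramSchmidtNormed_tupleAct, ← Set.indicator_comp_right (gramSchmidtNormed ℂ),
      ← Set.indicator_comp_right (tupleAct q U), Pi.one_comp, Pi.one_comp]
  -- Step 2: average over `U` and swap the integrals
  have hmeas : Measurable fun p : unitaryGroup (Fin m) ℂ × (Fin q → EuclideanSpace ℂ (Fin m)) =>
      φ (tupleAct q p.1 (gramSchmidtNormed ℂ p.2)) := by
    have hact : Measurable fun p : unitaryGroup (Fin m) ℂ × (Fin q → EuclideanSpace ℂ (Fin m)) =>
        tupleAct q p.1 (gramSchmidtNormed ℂ p.2) := by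
      refine measurable_pi_lambda _ fun j => ?_
      simp only [tupleAct_apply, unitaryEuclidean_apply]
      refine (WithLp.measurable_toLp 2 _).comp (measurable_pi_lambda _ fun i => ?_)
      simp only [mulVec, dotProduct]
      refine Finset.measurable_sum _ fun k _ => Measurable.mul ?_ ?_
      · have hU : Continuous fun U : unitaryGroup (Fin m) ℂ => (U : Matrix (Fin m) (Fin m) ℂ) i k :=
          (continuous_apply_apply i k).comp continuous_subtype_val
        exact hU.measurable.comp measurable_fst
      · have hw : Measurable fun w : Fin q → EuclideanSpace ℂ (Fin m) => (gramSchmidtNormed ℂ w j).ofLp k :=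
          (measurable_pi_apply k).comp ((WithLp.measurable_ofLp 2 _).comp
            (measurable_gramSchmidtNormed_apply ℂ j))
        exact hw.comp measurable_snd
    exact hφm.comp hact
  have step2 : γ (gramSchmidtNormed ℂ ⁻¹' B) =
      ∫⁻ f, ∫⁻ U, φ (tupleAct q U (gramSchmidtNormed ℂ f)) ∂H ∂γ := by
    calc γ (gramSchmidtNormed ℂ ⁻¹' B)
        = ∫⁻ _U, γ (gramSchmidtNormed ℂ ⁻¹' B) ∂H := by rw [lintegral_const, measure_univ, mul_one]
      _ = ∫⁻ U, ∫⁻ f, φ (tupleAct q U (gramSchmidtNormed ℂ f)) ∂γ ∂H := lintegral_congr step1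
      _ = ∫⁻ f, ∫⁻ U, φ (tupleAct q U (gramSchmidtNormed ℂ f)) ∂H ∂γ :=
          lintegral_lintegral_swap hmeas.aemeasurable
  -- Step 3: for a.e. `f` the inner integral is the Haar integral of `φ ∘ C`
  have step3 : ∀ᵐ f ∂γ, ∫⁻ U, φ (tupleAct q U (gramSchmidtNormed ℂ f)) ∂H =
      ∫⁻ U, φ (firstCols m q h U) ∂H := by
    filter_upwards [ae_linearIndependent_gaussianCols h] with f hf
    obtain ⟨W, hW⟩ := exists_unitary_firstCols_eq h (gramSchmidtNormed_orthonormal hf)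
    rw [← hW]
    simp_rw [← firstCols_mul]
    exact lintegral_mul_right_eq_self (fun U => φ (firstCols m q h U)) W
  rw [hHaar, step2, lintegral_congr_ae step3, lintegral_const, measure_univ, mul_one]

end Literature.Probability.RandomMatrix
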